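import Mathlib
import Summits.ValiantsHypothesis.ValiantsHypothesis.Theses.DivisionGap
import Literature.Computability.AlgebraicComplexity.ArithCircuitProofs
import Literature.Computability.AlgebraicComplexity.MonotoneStructure
import Summits.ValiantsHypothesis.ValiantsHypothesis.Theorems.PerDivisionHard.Negative.LoadBearing
import Summits.ValiantsHypothesis.ValiantsHypothesis.Theorems.PerDivisionHard.Negative.VarsCounting
import Summits.ValiantsHypothesis.ValiantsHypothesis.Theorems.PerDivisionHard.Negative.BooleanShadow
import Summits.ValiantsHypothesis.ValiantsHypothesis.Theorems.PerDivisionHard.Negative.PlainBridge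

/-!
# Line `birkhoff-face-descent` — skeleton for crux `PerDivisionHard` (stmt-ValiantsHypothesis-5065)

Crux (route `DivisionGap`, H1, FIXED):
`PerDivisionHard := ∀ c, ∃ n₀, ∀ n ≥ n₀, ∀ h : ℝ≥0[x_ij] (n × n), h ≠ 0 →
  2 ^ ((Nat.log 2 n + c) ^ c) < L(per_n · h) + L(h)`, `L = complexity` over `ℝ≥0`.

## The line (idea card `Ideas/birkhoff-face-descent.md`, merged by triage r1 with
`pair-descent-jss-endpoint` / `girth-face-rigidity`; sharpened by TRIAGE-r1-{1,2,3})

Weighted leading forms are FREE for monotone circuits over `ℝ≥0` (`stub_envelope`, Jerrum–Snir 1982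
Thm 2.4 / Jukna 2023 L.1.32 run with an arbitrary weight).  Driving the weight through the normal
fan of the Birkhoff polytope `B_n = Newt(per_n)`:

* lineality directions (row/column weights) make the cofactor WLOG torus-homogeneous at no cost
  (`stub_torus`);
* a face direction `w = W·𝟙_E + s` (`s < W` a slack off `E`) has `in_w(per_n) = per_E`, the
  perfect-matching polynomial of the bipartite graph `E`, and `in_w(per_n · h) = per_E · in_w(h)`
  (`stub_faceForms`);
* if `in_w(h)` is a single monomial `a·x^u` ("`h` is RIGID on the placed face `E`") the pair has
  descended to `(per_E · x^u, x^u)`, and a monomial cofactor is useless up to a quadratic loss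
  (`stub_contraction`, Jukna–Seiwert–Sergeev 2022 Thm 1 = Jukna 2023 Thm 6.11 / L.6.16 / Rem 6.19);
* faces from which `per_b` PROJECTS (intended witnesses: relabelled `G(b,k) ⊕ M₀` = `K_{b,b}` with
  every edge subdivided by `2k` vertices, padded by a perfect matching; phase bijection
  `PM(G(b,k)) ↔ PM(K_{b,b})`, TRIAGE-r1-2 F4 / r1-3 App. C) are super-quasi-polynomially hard as
  soon as `b ≥ (log₂ n + d)^d` (`stub_projectingFacesHard`, Jerrum–Snir via `PlainBridge`);
* the ONE OPEN STUB (`stub_rigidPlacement` = K2*/RigidHardFace of the triage): every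
  quasi-polynomially CHEAP torus-homogeneous `h ≠ 0` is rigid on SOME placed projecting face.
  Mechanism available to its prover (this card's survival criterion): with `s` generic off `E`,
  two top monomials tie iff they agree off `E`, hence differ by a nonzero circulation supported
  in `E`, whose support contains a cycle of `E`; placed `G(b,k) ⊕ M₀` has girth `8k+4`, which
  kills every product of factors with short exchange cycles (`h_L`, `U_ℓ^N`, block products,
  row/column-sum powers, `(Σ x)^K`, …, TRIAGE-r1-2 F5).  WARNING (this seat): the pairwise
  condition "no two max-`E`-mass monomials of `h` agree off `E`" is FALSE already for
  `U_4 = ∏_{4-cycles C} (x^{μ₁(C)} + x^{μ₂(C)})` on every `E` containing a cycle (fan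
  decomposition), although `U_4` IS rigid for generic `s`; only EDGES of the top `E`-face of
  `Newt(h)` matter.  Hence rigidity is stated with weights, exactly as the glue consumes it.

## Composition (`PerDivisionHard_of : PerDivisionHard`, no sorry of its own, pure logic over the six stubs)
Given `c`: `stub_contraction c ↦ (c', n₁)`, `stub_projectingFacesHard c' ↦ (d, n₂)`,
`stub_rigidPlacement c d ↦ n₀`.  For `n ≥ n₀+n₁+n₂`, `h ≠ 0`: torus step `h ↦ h'`; if
`L(per h) + L(h) ≤ 2^B` (`B = (log₂ n + c)^c`) then `L(h') ≤ 2^B`, so `h'` is rigid on a placed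
projecting face `E`: `L(per_E · a x^u) = L(in_w(per h')) ≤ L(per h') ≤ L(per h) ≤ 2^B`
(`stub_envelope`, `stub_faceForms`), rescale (`complexity_smul_le_holds`), contract
(`stub_contraction`): `L(per_E) ≤ 2^{B'}`, contradicting `stub_projectingFacesHard`.

## Disproof.lean obligations honoured (cdisprove gen 1–2)
* `perDivisionHard_false_without_nonzero`: `h ≠ 0` is used at `stub_torus` (leading forms of a
  nonzero polynomial are nonzero) and at `stub_rigidPlacement` (`a ≠ 0`).
* `not_perDivisionHardOver_of_charTwo` / `_zmod2` (no-cancellation is load-bearing): used at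
  `stub_envelope` (sum gates: top components cannot cancel), `stub_torus`/`stub_faceForms`
  (leading forms are multiplicative because `ℝ≥0[x]` has no zero divisors and supports add).
  All three are false over `𝔽₂`.
* `perDivisionHard_false_without_threshold` / `_false_uniform`: every stub is asymptotic with
  `n₀` depending on `c` (and `d`).
* tightness `not_perDivisionHardFactorialRate`: nothing claims more than `2^{polylog}` vs `2^{Ω(b)}`
  with `b` polylog.
* floor `perDivisionHardAt_zero/_one`, `sq_le_of_pair`: consistent (not used).
* Boolean shadow lemmas (`shadow_perPoly_mul_iff`, `…_prod_X_iff`): the line never passes to the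
  Boolean shadow; `h = ∏ x_ij` (void shadow) is a monomial, killed by `stub_contraction` directly.
* near-miss `not_perDivisionHard_imp_per_quasipoly_io`: consistent — the only open stub is a
  statement about cheap `h` alone.
No landed `Negative/` lemma refutes an instance of any stub (the Negative files are imported above
so that this is re-checked by elaboration of this file).
-/

noncomputable section

set_option linter.dupNamespace false

namespace Summit.ValiantsHypothesis.ValiantsHypothesis.Cruxes.PerDivisionHard.BirkhoffFaceDescent

open MvPolynomial Literature.Computability.AlgebraicComplexity
open scoped NNReal BigOperators

/-! ### Local vocabulary (transparent abbreviations over Mathlib / tree notions) -/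

/-- The leading form (initial form) of `f` in direction `w`: its weighted-homogeneous component
of maximal `w`-degree.  Faces of the Birkhoff polytope are reached with `w = faceWeight E W s`,
its lineality directions with row / column indicator weights. -/
def leadingForm {σ : Type} (w : σ → ℕ) (f : MvPolynomial σ ℝ≥0) : MvPolynomial σ ℝ≥0 :=
  weightedHomogeneousComponent w (weightedTotalDegree w f) f

/-- Torus homogeneity: all monomials of `h` have the same row margins and the same column
margins (`h` is a semi-invariant of `x_ij ↦ s_i t_j x_ij`).  `rowDegrees` is the tree's
(`MonotoneStructure.lean`); column margins are `Finsupp.mapDomain Prod.snd`. -/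
def IsTorusHomogeneous {n : ℕ} (h : MvPolynomial (Fin n × Fin n) ℝ≥0) : Prop :=
  ∃ r c : Fin n →₀ ℕ, ∀ m ∈ h.support, rowDegrees m = r ∧ Finsupp.mapDomain Prod.snd m = c

/-- The face permanent `per_E`: sum over the perfect matchings inside the edge set `E ⊆ [n]²`
(column-major like `perPoly`: the monomial of `σ` is `∏ i, X (σ i, i)`). -/
def facePer {n : ℕ} (E : Finset (Fin n × Fin n)) : MvPolynomial (Fin n × Fin n) ℝ≥0 :=
  ∑ σ ∈ (Finset.univ : Finset (Equiv.Perm (Fin n))).filter (fun σ => ∀ i, (σ i, i) ∈ E),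
    ∏ i, X (σ i, i)

/-- The face weight with slack: `W` on `E`, `s e` off `E` (admissible when `s e < W` off `E`). -/
def faceWeight {n : ℕ} (E : Finset (Fin n × Fin n)) (W : ℕ) (s : Fin n × Fin n → ℕ) :
    Fin n × Fin n → ℕ :=
  fun e => if e ∈ E then W else s e

/-- `per_b` is a PROJECTION of the face permanent `per_E` (Valiant's sense, monotone): substituting
a nonnegative constant or a variable of the `b × b` matrix for every variable turns `facePer E`
into `perPoly (Fin b) ℝ≥0`.  Intended witnesses: relabelled `G(b,k) ⊕ M₀` (phase bijection). -/
def Projects (n b : ℕ) (E : Finset (Fin n × Fin n)) : Prop :=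
  ∃ φ : Fin n × Fin n → MvPolynomial (Fin b × Fin b) ℝ≥0,
    (∀ e, (∃ a : ℝ≥0, φ e = C a) ∨ (∃ e', φ e = X e')) ∧
    aeval φ (facePer E) = perPoly (Fin b) ℝ≥0

/-! ### Registered stubs -/

/-- **stub_envelope (A1; weighted envelopes are free).**  Over `ℝ≥0` the leading form of `f` in
ANY direction `w : σ → ℕ` is computed by the same fan-in-two circuit with some sum operands dropped
(at a sum gate `c•u + d•v` keep the operands of maximal `w`-degree, at a product gate keep both:
`in_w(uv) = in_w(u) in_w(v)` since `ℝ≥0[x]` has no zero divisors, `in_w(cu+dv) ∈ {c in_w u,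
d in_w v, c in_w u + d in_w v}` since nothing cancels), so `L(in_w f) ≤ L(f)`.
Jerrum–Snir 1982 Thm 2.4 = Jukna, Tropical Circuit Complexity (2023) Lemma 1.32, there for the
total degree; the proof is weight-agnostic.  Gate-by-gate induction on `ArithCircuit.gateValues`
(template: `Negative/PlainBridge.lean`).  Size M–L.  False over `𝔽₂` (Disproof: charTwo). -/
theorem stub_envelope :
    ∀ {σ : Type} (w : σ → ℕ) (f : MvPolynomial σ ℝ≥0),
      complexity (leadingForm w f) ≤ complexity f := by
  sorry

/-- **stub_torus (A2; the torus-homogeneous normal form is free — the card's Transfer C⁺).**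
`per_n` is weighted-homogeneous of degree `1` for every row weight `𝟙[row = i]` and column weight
`𝟙[col = j]`, so `in_w(per·h) = per·in_w(h)` for these `2n` lineality weights (multiplicativity
of leading forms over `ℝ≥0`); iterating `h ↦ in_w(h)` over all of them (each step keeps `h ≠ 0`,
selects a sub-support, and by `stub_envelope` does not increase either complexity) ends at a
nonzero torus-homogeneous `h'`.  NOTE (TRIAGE-r1-1): substitution `x_off := 1` destroys torus
homogeneity, leading forms do not — this stub uses leading forms only.  Size M. -/
theorem stub_torus :
    ∀ (n : ℕ) (h : MvPolynomial (Fin n × Fin n) ℝ≥0), h ≠ 0 →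
      ∃ h' : MvPolynomial (Fin n × Fin n) ℝ≥0, h' ≠ 0 ∧ IsTorusHomogeneous h' ∧
        complexity (perPoly (Fin n) ℝ≥0 * h') ≤ complexity (perPoly (Fin n) ℝ≥0 * h) ∧
        complexity h' ≤ complexity h := by
  sorry

/-- **stub_faceForms (A3; faces of the Birkhoff polytope with slack).**  If `E` contains a perfect
matching and the slack is admissible (`s e < W` off `E`), then in direction `w = faceWeight E W s`
every permutation monomial inside `E` has weight `nW` and every other one has weight `< nW`, so
`in_w(per_n) = facePer E`; and leading forms are multiplicative over `ℝ≥0`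
(`weightedTotalDegree` is additive on nonzero factors because `in_w f · in_w g ≠ 0`), whence
`in_w(per_n · h) = facePer E · in_w(h)` (both sides `0` for `h = 0`).  Size M. -/
theorem stub_faceForms :
    ∀ (n : ℕ) (E : Finset (Fin n × Fin n)) (W : ℕ) (s : Fin n × Fin n → ℕ)
      (h : MvPolynomial (Fin n × Fin n) ℝ≥0),
      (∃ σ : Equiv.Perm (Fin n), ∀ i, (σ i, i) ∈ E) → (∀ e ∉ E, s e < W) →
      leadingForm (faceWeight E W s) (perPoly (Fin n) ℝ≥0 * h) =
        facePer E * leadingForm (faceWeight E W s) h := by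
  sorry

/-- **stub_contraction (A5; monomial cofactors are useless — the sink of the descent).**
Jukna–Seiwert–Sergeev 2022 Thm 1 (= Jukna 2023 Thm 6.11 with L.6.15–6.16 and Rem 6.19): if
`x^u · f` has a monotone circuit of size `s` in `N` variables then `f` has one of size `O(N³ s²)`
(gate by gate, divide every gate value `g_v` by its gcd monomial `x^{gcd g_v}`: products stay
products since supports add over `ℝ≥0`, a sum gate `c•g_u + d•g_w` needs two monomial multipliers
with exponents `≤ 2^s`, i.e. `O(N s)` extra product gates by repeated squaring; at the end
`[x^u f] = [f]` and `f = x^{gcd f} · [f]` costs `O(N s)` more).  Stated in the crux's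
quasi-polynomial currency on the variable set `Fin n × Fin n` (`N = n²`): `c' = c + 2` and
`n₁ = n₁(c)` absorb `poly(N) · (2^B + 2)²`.  Vendoring job (Literature fact in the general
polynomial form `L(f) ≤ K (N+1)^α (L(x^u f) + 1)²`, then this corollary).  Size L. -/
theorem stub_contraction :
    ∀ c : ℕ, ∃ c' n₁ : ℕ, ∀ n ≥ n₁,
      ∀ (f : MvPolynomial (Fin n × Fin n) ℝ≥0) (u : (Fin n × Fin n) →₀ ℕ),
        complexity (monomial u (1 : ℝ≥0) * f) ≤ 2 ^ ((Nat.log 2 n + c) ^ c) + 1 →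
        complexity f ≤ 2 ^ ((Nat.log 2 n + c') ^ c') := by
  sorry

/-- **stub_projectingFacesHard (the hard faces; proven technology).**  If `per_b` is a projection of
`facePer E` then `L(per_b) ≤ L(facePer E)` (replace variable operands by constants / renamed
variables: same gate count; `aeval` is a ring hom) and `b (2^{b-1} - 1) ≤ 2 L(per_b)`
(Jerrum–Snir 1982 §4.3 through `Negative/PlainBridge.js_le_two_mul_complexity_perPoly`); with
`b ≥ (log₂ n + d)^d`, `d = c + 2`, this beats `2^{(log₂ n + c)^c}` for `n ≥ n₁(c)`.
Size M (projection closure of `complexity` + `Nat.log` arithmetic). -/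
theorem stub_projectingFacesHard :
    ∀ c : ℕ, ∃ d n₁ : ℕ, ∀ n ≥ n₁,
      ∀ (b : ℕ) (E : Finset (Fin n × Fin n)), (Nat.log 2 n + d) ^ d ≤ b → Projects n b E →
        2 ^ ((Nat.log 2 n + c) ^ c) < complexity (facePer E) := by
  sorry

/-- **stub_rigidPlacement (K2* / RigidHardFace — the OPEN, load-bearing stub; hardest).**  Every
quasi-polynomially cheap, nonzero, torus-homogeneous cofactor `h` is RIGID on some placed hard
face: there are an edge set `E ⊆ [n]²` containing a perfect matching from which `per_b` projects,
`b ≥ (log₂ n + d)^d`, and an admissible slack `s < W` off `E`, such that the leading form of `h`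
in direction `faceWeight E W s` is a single monomial `a · x^u`.  A statement about `h` ALONE (no
`per · h`), hence not a costume.  Intended proof route: place a relabelled `G(b,k) ⊕ M₀`
(`b + k b² ≤ n` rows, girth `8k+4`, `Projects` by the phase bijection — these two facts are
provable now and should land first as `--supports` helpers) so that no EDGE of the top-`E`-mass
face of `Newt(h)` is a circulation supported in `E` (survival criterion of the card; generic
`s_e = (2D+1)^{j_e}` then exposes a vertex).  Verified by hand on every cheap family named in the
seven round-1 cards (TRIAGE-r1-2 F5, r1-3 App. C); per-like supports are excluded by the budget
(typed-vertex bound `L(per_n^M) ≥ C(n,⌈n/3⌉)`).  Why it might fail: a cheap non-product `h` with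
implicitly many long balanced exchange pairs on every placement; the naive union bound needs
`girth · log n ≳ log L(h)`.  Size: open (XL). -/
theorem stub_rigidPlacement :
    ∀ c d : ℕ, ∃ n₀ : ℕ, ∀ n ≥ n₀,
      ∀ h : MvPolynomial (Fin n × Fin n) ℝ≥0, h ≠ 0 → IsTorusHomogeneous h →
        complexity h ≤ 2 ^ ((Nat.log 2 n + c) ^ c) →
        ∃ (E : Finset (Fin n × Fin n)) (b W : ℕ) (s : Fin n × Fin n → ℕ)
          (u : (Fin n × Fin n) →₀ ℕ) (a : ℝ≥0),
          (∃ σ : Equiv.Perm (Fin n), ∀ i, (σ i, i) ∈ E) ∧ (Nat.log 2 n + d) ^ d ≤ b ∧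
          Projects n b E ∧ (∀ e ∉ E, s e < W) ∧ a ≠ 0 ∧
          leadingForm (faceWeight E W s) h = monomial u a := by
  sorry

/-! ### The kernel-checked composition -/

/-- **Composition (the audited skeleton theorem).**  Concludes the crux
`DivisionGap.PerDivisionHard` BY NAME from exactly the six registered stubs `stub_envelope`,
`stub_torus`, `stub_faceForms`, `stub_contraction`, `stub_projectingFacesHard`,
`stub_rigidPlacement` (invoked by name; `#print axioms` = whitelist ∪ {sorryAx via the stubs};
no `sorry` of its own).  Contrapositive chain, see the module docstring; no arithmetic beyond `+1`
bookkeeping, so reshaping a stub only ever touches its own call site here. -/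
theorem PerDivisionHard_of :
    Summit.ValiantsHypothesis.ValiantsHypothesis.Theses.DivisionGap.PerDivisionHard := by
  intro c
  obtain ⟨c', n₁, hcon⟩ := stub_contraction c
  obtain ⟨d, n₂, hhard⟩ := stub_projectingFacesHard c'
  obtain ⟨n₀, hrig⟩ := stub_rigidPlacement c d
  refine ⟨n₀ + n₁ + n₂, ?_⟩
  intro n hn h hh
  obtain ⟨h', hh', htor, hle1, hle2⟩ := stub_torus n h hh
  by_contra hlt
  push Not at hlt
  -- `hlt : L(per·h) + L(h) ≤ 2^B`; the pair is cheap, hence so is the normal form `h'`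
  have hcheap : complexity h' ≤ 2 ^ ((Nat.log 2 n + c) ^ c) :=
    le_trans hle2 (le_trans (Nat.le_add_left _ _) hlt)
  obtain ⟨E, b, W, s, u, a, hPM, hb, hproj, hadm, ha, hlf⟩ :=
    hrig n (by omega) h' hh' htor hcheap
  -- face descent: `in_w(per·h') = per_E · a x^u` is no more expensive than `per·h'`
  have hforms := stub_faceForms n E W s h' hPM hadm
  rw [hlf] at hforms
  have henv := stub_envelope (faceWeight E W s) (perPoly (Fin n) ℝ≥0 * h')
  rw [hforms] at henv
  -- rescale the coefficient `a ≠ 0` away (one `smul` gate)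
  have hkey : monomial u (1 : ℝ≥0) * facePer E = a⁻¹ • (facePer E * monomial u a) := by
    rw [mul_comm (monomial u (1 : ℝ≥0)) (facePer E),
      show monomial u a = a • monomial u (1 : ℝ≥0) by
        rw [smul_monomial, smul_eq_mul, mul_one],
      mul_smul_comm, inv_smul_smul₀ ha]
  have hresc : complexity (monomial u (1 : ℝ≥0) * facePer E) ≤
      complexity (facePer E * monomial u a) + 1 := by
    rw [hkey]
    exact complexity_smul_le_holds a⁻¹ _
  have h1 : complexity (monomial u (1 : ℝ≥0) * facePer E) ≤ 2 ^ ((Nat.log 2 n + c) ^ c) + 1 :=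
    calc complexity (monomial u (1 : ℝ≥0) * facePer E)
        ≤ complexity (facePer E * monomial u a) + 1 := hresc
      _ ≤ complexity (perPoly (Fin n) ℝ≥0 * h') + 1 := Nat.add_le_add_right henv 1
      _ ≤ complexity (perPoly (Fin n) ℝ≥0 * h) + 1 := Nat.add_le_add_right hle1 1
      _ ≤ 2 ^ ((Nat.log 2 n + c) ^ c) + 1 :=
          Nat.add_le_add_right (le_trans (Nat.le_add_right _ _) hlt) 1
  -- contract the monomial, and compare with the hardness of the projecting face
  have h2 := hcon n (by omega) (facePer E) u h1
  have h3 := hhard n (by omega) b E hb hproj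
  exact absurd (lt_of_lt_of_le h3 h2) (lt_irrefl _)

end Summit.ValiantsHypothesis.ValiantsHypothesis.Cruxes.PerDivisionHard.BirkhoffFaceDescent

end
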